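import Summits.BirchSwinnertonDyer.Rank1Residual.X11b.Three.GoodReductionSubgroupGaloisH1
import Literature.NumberTheory.EllipticCurves.NodeReductionMapProofs
import Literature.NumberTheory.EllipticCurves.SingularCubicMapProofs
import HarnessLib

/-!
# X11b at `p = 3` (team N8/O2), JET3-KUMMER (α), the `Ẽ_ns` half at a MULTIPLICATIVE place:
# the Galois behaviour of the node reduction map `r : E₀(L) → kˣ` over an abstract discrete
# valuation ring (Silverman *AEC* Exercise 3.5(a)), in p1's `JetchevKummerAtP` dictionary

HONEST FRAMING (cell `b2b-bsdres`, run/shared/lean/b2b/bsd-rank1-residual/, verbatim in every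
file): the goal of the cell is to DELETE the COMBINATION-SHAPED residual classes of the
Birch–Swinnerton-Dyer formula for ALL analytic-rank `≤ 1` elliptic curves over `ℚ` — "full BSD
formula for every rank `≤ 1` curve in class `C`" assembled STRICTLY from published theorems — so
that the rank-`≤ 1` remainder becomes exactly the CONSTRUCTION-SHAPED classes, which are TYPED
(missing-input `Prop`s), NOT attempted. This is not "finishing BSD". Team N8/O2 = `x11b3`, seat
`b2b-bsdres-x11b3-p4`, LEAD DEAL #4 row "JET3-KUMMER help-wanted (d) + (α)", part 4. THEOREMS
ONLY: no definition, no named fact, no `sorry`; nothing is booked; `JET@p|N` NOT discharged.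

## What

The tree's `WeierstrassCurve.exists_residueMap_nodeReduction_smul` (`NodeReductionGaloisProofs`,
setting: `w : Valuation L ℝ≥0`, model over `w.integer`, `σ` an isometry of `K̄_v`) computes how an
automorphism acts on the node reduction map `r : E₀(L) → kˣ` of
`WeierstrassCurve.exists_addMonoidHom_units_of_map_eq_singularModel` (`NodeReductionMapProofs`;
`r(a, b) = ψ(ā, b̄)`, kernel `E₁(L)`): through the residue field, EQUIVARIANTLY at a split node and
ANTI-equivariantly at a non-split node (Silverman, *AEC*, Exercise 3.5(a)). This file proves the
SAME statement in the dictionary of p1's `JetchevKummerAtP` — an ABSTRACT discrete valuation ring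
`R` with `IsFractionRing R L`, the Galois group `L ≃ₐ[F] L` acting on `(X ⊗ L)`-points by the tree
instance, `E₀(L) = goodReductionSubgroup R (X ⊗ L)` — so that the `Ẽ_ns` half of (α)
(`GoodReductionSubgroupReductionMapH1.h1red_of_reductionMap_of_cyclic`) can be instantiated at a
multiplicative place:

* §1 `integralModel_eq_of_baseChange_eq`, `reduction_eq_map_of_baseChange_eq`,
  `mem_goodReductionSubgroup_iff_hasNonsingularReduction_congrEquiv` — for an `R`-model `W₀` with
  `X ⊗ L = W₀ ⊗ L`: Mathlib's integral model of `X ⊗ L` is `W₀`, its reduction is `W₀ mod 𝔪`, and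
  `E₀` of `Tamagawa.lean` is `E₀` of `ReductionHomomorphism.lean` along `Affine.Point.congrEquiv`.
* §2 `exists_residueMap_nodeReduction_smul` — for `σ ∈ Aut(L/F)` with `τ(R) ⊆ R` for all `τ`
  (hypothesis `hR`, discharged for the ring of integers in part 2), a node presentation
  `W₀ mod 𝔪 = singularModel x₀ y₀ α₁ α₂` over the residue field `k` of `R`, and a homomorphism
  `r : E₀ → kˣ` with kernel `E₁` given on integral points by `ψ`: there is `σ̄ : k →+* k` with
  `σ̄ ā = \overline{σ a}`, fixing `x₀, y₀`, and EITHER `σ̄` fixes `α₁, α₂` and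
  `r(σ • P) = σ̄(r P)` on `E₀`, OR `σ̄` swaps them and `r(σ • P) = σ̄(r P)⁻¹`. Proof transcribed
  from the tree file (same mechanism: `σ̄` fixes `W̃₀`, hence its singular point, and permutes the
  tangent slopes — `singularModel.apply_eq_of_map_eq`; `ψ` under ring maps —
  `singularModel.nodeFun_map_some` / `nodeFun_swap_some`; `r = 1` on `E₁`).

References (locators only; no new fact): [cite: SilvermanAEC2009, Exercise 3.5(a) (PDF p. 97),
VII.§5 (PDF p. 174), VII.2 Prop. 2.1 and Prop. III.2.5(a) (PDF pp. 167, 59)]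
[cite: NeukirchANT1999, Ch. II §9 (decomposition group and residue field)].

## Design

No definitions; `noncomputable section`; `open scoped Classical`; universe `u` for `F`, `L`;
`R` abstract with `hv = integers_valuationRing_valuation R L` supplied inline; the residue
endomorphism is produced existentially with its defining property. Axioms: `propext`,
`Classical.choice`, `Quot.sound`.
-/

noncomputable section

open scoped Classical

namespace Summit.BirchSwinnertonDyer.Rank1Residual.X11b.Three.JetchevKummer

open WeierstrassCurve Literature.NumberTheory.EllipticCurves

universe u

variable {F : Type u} [Field F] (X : WeierstrassCurve F) (L : Type u) [Field L] [Algebra F L]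
  (R : Type*) [CommRing R] [IsDomain R] [IsDiscreteValuationRing R] [Algebra R L]
  [IsFractionRing R L] (W₀ : WeierstrassCurve R) (hX : X.baseChange L = W₀.baseChange L)

/-! ### §1 `E₀` of `Tamagawa.lean` versus `E₀` of `ReductionHomomorphism.lean` for an `R`-model -/

omit [IsDomain R] [IsDiscreteValuationRing R] in
include hX in
/-- Mathlib's integral model of `X ⊗ L` is the given `R`-model `W₀` (`R → L` is injective).
[folklore] -/
theorem integralModel_eq_of_baseChange_eq [(X.baseChange L).IsIntegral R] :
    (X.baseChange L).integralModel R = W₀ := by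
  apply WeierstrassCurve.map_injective (IsFractionRing.injective R L)
  change ((X.baseChange L).integralModel R).map (algebraMap R L) = W₀.baseChange L
  rw [← hX]
  exact baseChange_integralModel_eq R (X.baseChange L)

include hX in
/-- Hence the reduction of `X ⊗ L` is `W₀ mod 𝔪`. [folklore] -/
theorem reduction_eq_map_of_baseChange_eq [(X.baseChange L).IsMinimal R] :
    (X.baseChange L).reduction R = W₀.map (IsLocalRing.residue R) := by
  rw [WeierstrassCurve.reduction, integralModel_eq_of_baseChange_eq X L R W₀ hX]

/-- **`E₀` of `Tamagawa.lean` is `E₀` of `ReductionHomomorphism.lean`** along the transport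
`Affine.Point.congrEquiv hX : (X ⊗ L).Point ≃+ (W₀ ⊗ L).Point` (identity on coordinates): for the
`R`-minimal `X ⊗ L` with `R`-model `W₀`, `Q ∈ goodReductionSubgroup R (X ⊗ L)` iff
`W₀.HasNonsingularReduction (congrEquiv hX Q)`. Silverman, *AEC* VII.2 (one notion). [folklore] -/
theorem mem_goodReductionSubgroup_iff_hasNonsingularReduction_congrEquiv
    [(X.baseChange L).IsMinimal R] (Q : (X.baseChange L).toAffine.Point) :
    Q ∈ (X.baseChange L).goodReductionSubgroup R ↔
      W₀.HasNonsingularReduction (Affine.Point.congrEquiv hX Q) := by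
  rw [WeierstrassCurve.mem_goodReductionSubgroup_iff_holds R (X.baseChange L) Q]
  rcases Q with _ | ⟨x, y, h⟩
  · rw [show (Affine.Point.zero : (X.baseChange L).toAffine.Point) = 0 from rfl, map_zero]
    exact Iff.rfl
  · rw [Affine.Point.congrEquiv_some]
    simp only [IsNonsingularReductionPoint, HasNonsingularReduction,
      reduction_eq_map_of_baseChange_eq X L R W₀ hX]

/-! ### §2 The decomposition group acts on the node reduction map through the residue field -/

/-- **An automorphism preserving `R` acts on `r = ψ ∘ reduction` through the residue field,
equivariantly or anti-equivariantly** — Silverman, *AEC*, Exercise 3.5(a), in the dictionary of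
`JetchevKummerAtP`. Let `X / F`, `L ⊇ F` with discrete valuation ring `R` (`Frac R = L`) such that
every `τ ∈ Aut(L/F)` maps `R` into `R` (`hR`), `W₀` an `R`-model of `X ⊗ L` (`hX`) whose reduction
is a presented node `W̃₀ = singularModel x₀ y₀ α₁ α₂` over the residue field `k` (`hW`), and
`r : E₀ →+ kˣ` a homomorphism with kernel `E₁` (`hr0`) given on integral points by
`r(a, b) = ψ(ā, b̄)` (`hr`; such an `r` is `exists_addMonoidHom_units_of_map_eq_singularModel`).
Then for `σ ∈ Aut(L/F)` there is a ring endomorphism `σ̄` of `k` with `σ̄ ā = \overline{σ a}`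
(`a ∈ R`), `E₀` is `σ`-stable, `σ̄` fixes `x₀, y₀`, and EITHER `σ̄ α₁ = α₁`, `σ̄ α₂ = α₂` and
`r(σ • P) = σ̄ (r P)` for all `P ∈ E₀` (split node), OR `σ̄ α₁ = α₂`, `σ̄ α₂ = α₁` and
`r(σ • P) = σ̄ (r P)⁻¹` (non-split node). Transcription of the tree's
`WeierstrassCurve.exists_residueMap_nodeReduction_smul` (there: `σ` an isometry of `K̄_v`, model
over `𝒪_w`). [cite: SilvermanAEC2009, Exercise 3.5(a) and VII.§5 (PDF pp. 97, 174)]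
[cite: NeukirchANT1999, Ch. II §9] -/
theorem exists_residueMap_nodeReduction_smul
    (hR : ∀ (τ : L ≃ₐ[F] L) (x : L), x ∈ Set.range (algebraMap R L) →
      τ x ∈ Set.range (algebraMap R L))
    (σ : L ≃ₐ[F] L) {x₀ y₀ α₁ α₂ : IsLocalRing.ResidueField R}
    (hW : W₀.map (IsLocalRing.residue R) = singularModel x₀ y₀ α₁ α₂)
    (r : W₀.nonsingularReductionSubgroup (integers_valuationRing_valuation R L) →+
      Additive (IsLocalRing.ResidueField R)ˣ)
    (hr0 : ∀ P : W₀.nonsingularReductionSubgroup (integers_valuationRing_valuation R L),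
      r P = 0 ↔ W₀.ReducesToZero (P : (W₀.baseChange L).toAffine.Point))
    (hr : ∀ (a b : R)
      (h : (W₀.baseChange L).toAffine.Nonsingular (algebraMap R L a) (algebraMap R L b))
      (hns : (singularModel x₀ y₀ α₁ α₂).toAffine.Nonsingular (IsLocalRing.residue R a)
        (IsLocalRing.residue R b))
      (hP : W₀.HasNonsingularReduction (.some _ _ h)),
      ((r ⟨.some _ _ h, hP⟩).toMul : IsLocalRing.ResidueField R) =
        singularModel.nodeFun x₀ y₀ α₁ α₂ (.some _ _ hns)) :
    ∃ σk : IsLocalRing.ResidueField R →+* IsLocalRing.ResidueField R,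
      (∀ a a' : R, algebraMap R L a' = σ (algebraMap R L a) →
        σk (IsLocalRing.residue R a) = IsLocalRing.residue R a') ∧
      (∀ P : (X.baseChange L).toAffine.Point,
        W₀.HasNonsingularReduction (Affine.Point.congrEquiv hX P) →
          W₀.HasNonsingularReduction (Affine.Point.congrEquiv hX (σ • P))) ∧
      σk x₀ = x₀ ∧ σk y₀ = y₀ ∧
      ((σk α₁ = α₁ ∧ σk α₂ = α₂ ∧
        ∀ (P : (X.baseChange L).toAffine.Point)
          (hP : W₀.HasNonsingularReduction (Affine.Point.congrEquiv hX P))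
          (hσP : W₀.HasNonsingularReduction (Affine.Point.congrEquiv hX (σ • P))),
          ((r ⟨_, hσP⟩).toMul : IsLocalRing.ResidueField R) =
            σk ((r ⟨_, hP⟩).toMul : IsLocalRing.ResidueField R)) ∨
       (σk α₁ = α₂ ∧ σk α₂ = α₁ ∧
        ∀ (P : (X.baseChange L).toAffine.Point)
          (hP : W₀.HasNonsingularReduction (Affine.Point.congrEquiv hX P))
          (hσP : W₀.HasNonsingularReduction (Affine.Point.congrEquiv hX (σ • P))),
          ((r ⟨_, hσP⟩).toMul : IsLocalRing.ResidueField R) =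
            (σk ((r ⟨_, hP⟩).toMul : IsLocalRing.ResidueField R))⁻¹)) := by
  have hv := integers_valuationRing_valuation R L
  have hinj : Function.Injective (algebraMap R L) := IsFractionRing.injective R L
  -- `σ` restricted to `R`: a local endomorphism (its inverse `σ⁻¹` also preserves `R`)
  have hex : ∀ a : R, ∃ a' : R, algebraMap R L a' = σ (algebraMap R L a) := fun a ↦ by
    obtain ⟨a', ha'⟩ := hR σ (algebraMap R L a) ⟨a, rfl⟩
    exact ⟨a', ha'⟩
  choose f hf using hex
  let σR : R →+* R :=
    { toFun := f
      map_one' := hinj (by simp only [hf, map_one])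
      map_mul' := fun a b ↦ hinj (by simp only [hf, map_mul])
      map_zero' := hinj (by simp only [hf, map_zero])
      map_add' := fun a b ↦ hinj (by simp only [hf, map_add]) }
  have hσR : ∀ a : R, algebraMap R L (σR a) = σ (algebraMap R L a) := hf
  haveI : IsLocalHom σR := by
    refine ⟨fun a ha ↦ ?_⟩
    obtain ⟨b, hb⟩ := isUnit_iff_exists_inv.mp ha
    obtain ⟨b', hb'⟩ := hR σ⁻¹ (algebraMap R L b) ⟨b, rfl⟩
    refine isUnit_iff_exists_inv.mpr ⟨b', hinj ?_⟩
    rw [map_mul, map_one, hb']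
    have h1 : σ (algebraMap R L a) * algebraMap R L b = 1 := by
      rw [← hσR, ← map_mul, hb, map_one]
    have h2 := congrArg (σ⁻¹ : L ≃ₐ[F] L) h1
    rw [map_mul, map_one] at h2
    rwa [show (σ⁻¹ : L ≃ₐ[F] L) (σ (algebraMap R L a)) = algebraMap R L a from
      σ.symm_apply_apply _] at h2
  set σk : IsLocalRing.ResidueField R →+* IsLocalRing.ResidueField R :=
    IsLocalRing.ResidueField.map σR with hσkdef
  have hσk : ∀ a : R, σk (IsLocalRing.residue R a) = IsLocalRing.residue R (σR a) := fun a ↦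
    IsLocalRing.ResidueField.map_residue σR a
  -- `σ` fixes the coefficients of `W₀` (they come from `F`), so `σ̄` fixes the reduction
  have hcoef : ∀ {c : R} {x : F}, algebraMap F L x = algebraMap R L c → σR c = c := by
    intro c x hcx
    exact hinj (by rw [hσR, ← hcx, AlgEquiv.commutes])
  have hWσ : W₀.map σR = W₀ := by
    have h1 := congrArg WeierstrassCurve.a₁ hX
    have h2 := congrArg WeierstrassCurve.a₂ hX
    have h3 := congrArg WeierstrassCurve.a₃ hX
    have h4 := congrArg WeierstrassCurve.a₄ hX
    have h6 := congrArg WeierstrassCurve.a₆ hX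
    simp only [baseChange, map_a₁, map_a₂, map_a₃, map_a₄, map_a₆] at h1 h2 h3 h4 h6
    ext
    · exact hcoef h1
    · exact hcoef h2
    · exact hcoef h3
    · exact hcoef h4
    · exact hcoef h6
  have hWk : (singularModel x₀ y₀ α₁ α₂).map σk = singularModel x₀ y₀ α₁ α₂ := by
    rw [← hW, map_map, hσkdef, IsLocalRing.ResidueField.map_comp_residue, ← map_map, hWσ]
  obtain ⟨hx₀, hy₀, hslopes⟩ := singularModel.apply_eq_of_map_eq hWk
  -- residues of `σ`-moved integers
  have hσres : ∀ a a' : R, algebraMap R L a' = σ (algebraMap R L a) →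
      σk (IsLocalRing.residue R a) = IsLocalRing.residue R a' := by
    intro a a' h
    rw [hσk, show σR a = a' from hinj (by rw [hσR, h])]
  -- the moved point, on coordinates
  have hsmul : ∀ {x y : L} (h : (X.baseChange L).toAffine.Nonsingular x y),
      ∃ h' : (X.baseChange L).toAffine.Nonsingular (σ x) (σ y), σ • (Affine.Point.some x y h) =
        .some _ _ h' := by
    intro x y h
    rw [WeierstrassCurve.smul_def, Affine.Point.map_some]
    exact ⟨_, rfl⟩
  have hmove : ∀ {x y : L} (h : (X.baseChange L).toAffine.Nonsingular x y),
      ∃ h' : (W₀.baseChange L).toAffine.Nonsingular (σ x) (σ y),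
        Affine.Point.congrEquiv hX (σ • (Affine.Point.some x y h)) = .some _ _ h' := by
    intro x y h
    obtain ⟨h₁, hh₁⟩ := hsmul h
    rw [hh₁, Affine.Point.congrEquiv_some]
    exact ⟨_, rfl⟩
  have hfix : ∀ {x y : L} (h : (X.baseChange L).toAffine.Nonsingular x y),
      ∃ h' : (W₀.baseChange L).toAffine.Nonsingular x y,
        Affine.Point.congrEquiv hX (.some x y h) = .some _ _ h' := by
    intro x y h
    rw [Affine.Point.congrEquiv_some]
    exact ⟨_, rfl⟩
  -- integral points: reduction of `(a, b)` and of `(σ a, σ b)`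
  have hns_iff : ∀ {a b : R}
      (h : (W₀.baseChange L).toAffine.Nonsingular (algebraMap R L a) (algebraMap R L b)),
      W₀.HasNonsingularReduction (.some _ _ h) ↔
        (singularModel x₀ y₀ α₁ α₂).toAffine.Nonsingular (IsLocalRing.residue R a)
          (IsLocalRing.residue R b) := by
    intro a b h
    rw [hasNonsingularReduction_some_algebraMap_iff hinj h, hW]
  -- a non-integral `x` stays non-integral under `σ` (`σ⁻¹` preserves `R`)
  have hnonint : ∀ {x : L}, x ∉ Set.range (algebraMap R L) → σ x ∉ Set.range (algebraMap R L) := by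
    intro x hx hσx
    apply hx
    obtain ⟨c, hc⟩ := hR σ⁻¹ (σ x) hσx
    exact ⟨c, by rw [hc]; exact σ.symm_apply_apply x⟩
  -- integral coordinates: `x = a`, `y = b`, `σ x = σR a`, `σ y = σR b`
  have hint : ∀ {x y : L}, (W₀.baseChange L).toAffine.Nonsingular x y →
      x ∈ Set.range (algebraMap R L) →
        ∃ a b : R, algebraMap R L a = x ∧ algebraMap R L b = y ∧
          algebraMap R L (σR a) = σ x ∧ algebraMap R L (σR b) = σ y := by
    rintro x y h ⟨a, rfl⟩
    have hy : ValuationRing.valuation R L y ≤ 1 :=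
      v_Y_le_one_of_v_X_le_one hv h.1 (hv.map_le_one a)
    obtain ⟨b, rfl⟩ := hv.exists_of_le_one hy
    exact ⟨a, b, rfl, rfl, hσR a, hσR b⟩
  -- `E₀` is `σ`-stable
  have hstable : ∀ P : (X.baseChange L).toAffine.Point,
      W₀.HasNonsingularReduction (Affine.Point.congrEquiv hX P) →
        W₀.HasNonsingularReduction (Affine.Point.congrEquiv hX (σ • P)) := by
    intro P hP
    rcases P with _ | ⟨x, y, h⟩
    · rw [show (Affine.Point.zero : (X.baseChange L).toAffine.Point) = 0 from rfl, smul_zero,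
        map_zero]
      trivial
    · obtain ⟨h', hh'⟩ := hmove h
      obtain ⟨h₀, hh₀⟩ := hfix h
      rw [hh']
      rw [hh₀] at hP
      by_cases hx : x ∈ Set.range (algebraMap R L)
      · obtain ⟨a, b, rfl, rfl, hσa, hσb⟩ := hint h₀ hx
        have hns := (hns_iff h₀).mp hP
        have hσns := singularModel.nonsingular_map σk hns
        rw [hx₀, hy₀, hσk, hσk] at hσns
        have h'' : (W₀.baseChange L).toAffine.Nonsingular (algebraMap R L (σR a))
            (algebraMap R L (σR b)) := by rw [hσa, hσb]; exact h'
        have key : W₀.HasNonsingularReduction (.some _ _ h'') := by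
          rw [hns_iff h'']
          rcases hslopes with ⟨h₁, h₂⟩ | ⟨h₁, h₂⟩
          · rw [h₁, h₂] at hσns; exact hσns
          · rw [h₁, h₂] at hσns; exact singularModel.nonsingular_swap hσns
        have heq : (Affine.Point.some _ _ h' : (W₀.baseChange L).toAffine.Point) = .some _ _ h'' :=
          point_some_congr hσa.symm hσb.symm
        rw [heq]
        exact key
      · exact Or.inl (hnonint hx)
  refine ⟨σk, hσres, hstable, hx₀, hy₀, ?_⟩
  -- `r = 1` on `E₁`
  have hone : ∀ (Q : (W₀.baseChange L).toAffine.Point) (hQ : W₀.HasNonsingularReduction Q),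
      W₀.ReducesToZero Q → ((r ⟨Q, hQ⟩).toMul : IsLocalRing.ResidueField R) = 1 := by
    intro Q hQ h0
    have := (hr0 ⟨Q, hQ⟩).mpr h0
    rw [this, toMul_zero, Units.val_one]
  -- the value of `r` on a moved point (points generalized, so that `subst` applies)
  have key : ∀ (Q Qσ : (W₀.baseChange L).toAffine.Point) (hQ : W₀.HasNonsingularReduction Q)
      (hQσ : W₀.HasNonsingularReduction Qσ) (P : (X.baseChange L).toAffine.Point),
      Affine.Point.congrEquiv hX P = Q →
      Affine.Point.congrEquiv hX (σ • P) = Qσ →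
      ((σk α₁ = α₁ ∧ σk α₂ = α₂) →
        ((r ⟨Qσ, hQσ⟩).toMul : IsLocalRing.ResidueField R) =
          σk ((r ⟨Q, hQ⟩).toMul : IsLocalRing.ResidueField R)) ∧
      ((σk α₁ = α₂ ∧ σk α₂ = α₁) →
        ((r ⟨Qσ, hQσ⟩).toMul : IsLocalRing.ResidueField R) =
          (σk ((r ⟨Q, hQ⟩).toMul : IsLocalRing.ResidueField R))⁻¹) := by
    intro Q Qσ hQ hQσ P hPQ hPQσ
    rcases P with _ | ⟨x, y, h⟩
    · -- `P = O`: both sides are `1`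
      have hQ0 : Q = 0 := by
        rw [← hPQ, show (Affine.Point.zero : (X.baseChange L).toAffine.Point) = 0 from rfl, map_zero]
      have hQσ0 : Qσ = 0 := by
        rw [← hPQσ, show (Affine.Point.zero : (X.baseChange L).toAffine.Point) = 0 from rfl,
          smul_zero, map_zero]
      subst hQ0
      subst hQσ0
      rw [hone 0 hQσ reducesToZero_zero, map_one, inv_one]
      exact ⟨fun _ ↦ rfl, fun _ ↦ rfl⟩
    · obtain ⟨h', hh'⟩ := hmove h
      obtain ⟨h₀, hh₀⟩ := hfix h
      rw [hh₀] at hPQ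
      rw [hh'] at hPQσ
      subst hPQ
      subst hPQσ
      by_cases hx : x ∈ Set.range (algebraMap R L)
      · -- integral point: `r (a, b) = ψ(ā, b̄)`, `r (σ a, σ b) = ψ(σ̄ ā, σ̄ b̄)`
        obtain ⟨a, b, rfl, rfl, hσa, hσb⟩ := hint h₀ hx
        have h'' : (W₀.baseChange L).toAffine.Nonsingular (algebraMap R L (σR a))
            (algebraMap R L (σR b)) := by rw [hσa, hσb]; exact h'
        have hQσ' : W₀.HasNonsingularReduction (.some _ _ h'') := by
          rw [← point_some_congr (h := h') (h' := h'') hσa.symm hσb.symm]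
          exact hQσ
        have hns := (hns_iff h₀).mp hQ
        have hσns' := singularModel.nonsingular_map σk hns
        rw [hx₀, hy₀, hσk, hσk] at hσns'
        have hrP : ((r ⟨.some _ _ h₀, hQ⟩).toMul : IsLocalRing.ResidueField R) =
            singularModel.nodeFun x₀ y₀ α₁ α₂ (.some _ _ hns) := hr a b h₀ hns hQ
        have eQσ : (⟨.some (σ (algebraMap R L a)) (σ (algebraMap R L b)) h', hQσ⟩ :
            W₀.nonsingularReductionSubgroup hv) = ⟨.some _ _ h'', hQσ'⟩ :=
          Subtype.ext (point_some_congr hσa.symm hσb.symm)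
        rw [eQσ, hrP]
        constructor
        · rintro ⟨h₁, h₂⟩
          have hσns : (singularModel x₀ y₀ α₁ α₂).toAffine.Nonsingular
              (IsLocalRing.residue R (σR a)) (IsLocalRing.residue R (σR b)) := by
            rw [h₁, h₂] at hσns'; exact hσns'
          rw [hr (σR a) (σR b) h'' hσns hQσ']
          simp only [singularModel.nodeFun, map_div₀, map_sub, map_mul, hσk, hx₀, hy₀, h₁, h₂]
        · rintro ⟨h₁, h₂⟩
          have hσns : (singularModel x₀ y₀ α₁ α₂).toAffine.Nonsingular
              (IsLocalRing.residue R (σR a)) (IsLocalRing.residue R (σR b)) := by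
            rw [h₁, h₂] at hσns'
            exact singularModel.nonsingular_swap (α₁ := α₂) (α₂ := α₁) hσns'
          rw [hr (σR a) (σR b) h'' hσns hQσ']
          simp only [singularModel.nodeFun, map_div₀, map_sub, map_mul, hσk, hx₀, hy₀, h₁, h₂,
            inv_div]
      · -- a point of `E₁`: both sides are `1`
        have h0P : W₀.ReducesToZero (.some x y h₀) := (reducesToZero_some_iff h₀).mpr hx
        have h0σ : W₀.ReducesToZero (.some (σ x) (σ y) h') :=
          (reducesToZero_some_iff h').mpr (hnonint hx)
        rw [hone _ hQσ h0σ, hone _ hQ h0P, map_one, inv_one]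
        exact ⟨fun _ ↦ rfl, fun _ ↦ rfl⟩
  rcases hslopes with ⟨h₁, h₂⟩ | ⟨h₁, h₂⟩
  · exact Or.inl ⟨h₁, h₂, fun P hP hσP ↦ (key _ _ hP hσP P rfl rfl).1 ⟨h₁, h₂⟩⟩
  · exact Or.inr ⟨h₁, h₂, fun P hP hσP ↦ (key _ _ hP hσP P rfl rfl).2 ⟨h₁, h₂⟩⟩

end Summit.BirchSwinnertonDyer.Rank1Residual.X11b.Three.JetchevKummer

end
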